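import Literature.MathematicalPhysics.QuantumLattice.Imbrie2016.LLA

/-!
# Imbrie (2016), Assumption LLA: kernel-checked skeleton of the SECOND-ORDER WINDOW THEOREM (audit cell, LLA.md block WG)

CITATION HEADER (lean-in-tree rule 2026-08-18). J. Z. Imbrie, *On many-body localization for quantum spin chains*,
J. Stat. Phys. **163** (2016) 998–1048, doi 10.1007/s10955-016-1508-x, arXiv:1403.7837 [ImbrieJSP2016]: eq. (1.1) (the block
Hamiltonian `H = Σ h_i S^z_i + Σ J_i S^z_i S^z_{i+1} + γ Σ Γ_i S^x_i`), eq. (1.3) (Assumption LLA(ν, C): `P(min gap < δ) ≤ Cⁿ δ^ν`).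
Nearest published analogue of the window device: J. Z. Imbrie, R. Mavi, *Level spacing for non-monotone Anderson models*,
J. Stat. Phys. **162** (2016) 1451–1484, arXiv:1506.06692, Remark 3 (Weyl window for the one-body block model).

WHAT IS PROVED (lemmas of the audit cell `pub-imbrie`, LLA.md gen-13 block WG — NOT statements of [ImbrieJSP2016], which assumes
LLA and proves nothing about it; LLA itself is NOT asserted here). Block WG proves on paper, for `H = Σ h_i Z_i + D + T` with `D`
diagonal and `T` Hermitian independent of `h` (densities `≤ ρ₀`), `‖T‖ ≤ t₀`:  `P(min gap < δ) ≤ 8^m ρ₀ (δ + 32 ρ₀ t₀²)` for all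
`δ > 0` — the LLA shape with `ν = 1`, `C_m → 8` on the window `δ ≥ 32 ρ₀ t₀²`, uniformly in frozen transverse fields. This file
kernel-checks the four elementary nodes of that proof which are NOT matrix analysis:
  * `exists_minor_ne_zero`, `four_le_abs_minor` (step (B)): for three distinct spin configurations `σ, σ', τ` the coefficient rows
    of `E_σ − E_σ'` and `E_τ − E_σ` (entries in `{0, ±2}`) have a 2×2 minor of absolute value `≥ 4` — so a non-isolated resonant
    pair costs TWO independent field variables;
  * `gap_skeleton` (step (C3)): the order-theoretic heart of the Feshbach argument — if `φ₋ ≤ φ₊` decrease at rate `≥ 1`, `φ₊` at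
    rate `≤ 1 + θ`, and `a < b` are zeros of `φ₋` or `φ₊`, then `a` is the zero of `φ₋`, `b` the zero of `φ₊`, and
    `φ₊ a − φ₋ a ≤ (1 + θ)(b − a)` (gap ≥ spread / (1 + θ));
  * `volume_abs_lt_le_of_coLipschitz`, `volume_window_le_of_lipschitz_perturbation` (step (D)): a one-variable Wegner estimate
    for `u(x) = 2 s x + v(x)`, `|s| = 1`, `v` λ-Lipschitz with `λ < 2`: `Leb{x ∈ I : |u x| < ε} ≤ 2ε/(2 − λ)`;
  * `wg_constants`, `wg_counts_pairs`, `wg_counts_triples`, `wg_window_bound`, `wg_weyl_into_unified` (the arithmetic of WG: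
    `d = 4t₀`, `θ = 1/16`, `λ = 1/4`, `KL = 32 t₀²`, `2(1+θ)/(2−λ) = 17/14`, the counts `≤ 8^m`, and the window inequality).
NOT kernel-checked here (paper proof LLA.md WG2, inputs audited there): Weyl's inequality for `H_cl + T`, the Schur-complement
identity `dim ker(H − e) = dim ker(F(e) − e)`, the resolvent bounds `‖F′‖ ≤ t₀²/d²`, and the Fubini assembly over the box law.
STATUS: elementary, unconditional; says nothing about LLA below the window. LLA remains the OPEN, UNPROVED hypothesis of
[ImbrieJSP2016, Thm 1.1] (cell verdict: open). Unit b2b-imbrie-1-g13 (gen 13 of the LLA seat). No `sorry`, no new axioms.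
-/

noncomputable section
open _root_.MeasureTheory Set

namespace Literature.MathematicalPhysics.QuantumLattice.Imbrie2016

namespace SecondOrderWindow

/-! ## Step (B): three distinct configurations give two independent field directions -/

/-- the value `±1` of a spin (`true ↦ 1`, `false ↦ -1`), as a real number. [cite: ImbrieJSP2016, eq. (1.1)] -/
def pm (b : Bool) : ℝ := if b then 1 else -1

/-- `pm` is injective. [folklore] -/
theorem pm_injective {a b : Bool} (h : pm a = pm b) : a = b := by
  cases a <;> cases b <;> simp [pm] at h ⊢ <;> norm_num at h

/-- the 2×2 minor, in columns `i, j`, of the coefficient rows of `E_σ − E_σ'` (row `pm σ − pm σ'`) and `E_τ − E_σ`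
(row `pm τ − pm σ`) as linear forms in the fields `h`. [cite: ImbrieJSP2016, eq. (1.1)] -/
def minor {m : ℕ} (σ σ' τ : Cfg m) (i j : Fin m) : ℝ :=
  (pm (σ i) - pm (σ' i)) * (pm (τ j) - pm (σ j)) - (pm (σ j) - pm (σ' j)) * (pm (τ i) - pm (σ i))

/-- **Step (B), combinatorial core.** For three pairwise distinct configurations the two coefficient rows are linearly
independent: some 2×2 minor is non-zero. (If all minors vanished: pick `i` with `σ i ≠ σ' i`; either `τ i = σ i`, forcing
`τ = σ`, or `τ i = σ' i`, forcing `τ = σ'`.) (LLA.md WG2 (B)) [folklore] -/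
theorem exists_minor_ne_zero {m : ℕ} {σ σ' τ : Cfg m} (h1 : σ ≠ σ') (h2 : τ ≠ σ) (h3 : τ ≠ σ') :
    ∃ i j : Fin m, minor σ σ' τ i j ≠ 0 := by
  by_contra hcon
  push Not at hcon
  obtain ⟨i, hi⟩ := Function.ne_iff.mp h1
  have hA : pm (σ i) - pm (σ' i) ≠ 0 := fun h => hi (pm_injective (sub_eq_zero.mp h))
  by_cases hτ : τ i = σ i
  · -- then the first row kills every entry of the second row: τ = σ
    apply h2
    funext j
    have hm := hcon i j
    simp only [minor, hτ, sub_self, mul_zero, sub_zero] at hm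
    rcases mul_eq_zero.mp hm with h | h
    · exact absurd h hA
    · exact pm_injective (sub_eq_zero.mp h)
  · -- then τ i = σ' i and the minors force τ = σ'
    have hτ' : τ i = σ' i := by
      revert hi hτ; cases τ i <;> cases σ i <;> cases σ' i <;> simp
    apply h3
    funext j
    have hm := hcon i j
    have : minor σ σ' τ i j = (pm (σ i) - pm (σ' i)) * (pm (τ j) - pm (σ' j)) := by
      simp only [minor, hτ']; ring
    rw [this] at hm
    rcases mul_eq_zero.mp hm with h | h
    · exact absurd h hA
    · exact pm_injective (sub_eq_zero.mp h)

/-- **Step (B), size of the Jacobian.** Every non-zero minor has absolute value `≥ 4` (its two products lie in `{0, ±4}`).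
Hence the affine map `(h_i, h_j) ↦ (E_σ − E_σ', E_τ − E_σ)` shrinks areas by at most `1/4`: the preimage of a `2K × 2L`
rectangle has area `≤ KL`. (LLA.md WG2 (B)) [folklore] -/
theorem four_le_abs_minor {m : ℕ} (σ σ' τ : Cfg m) (i j : Fin m) (h : minor σ σ' τ i j ≠ 0) :
    4 ≤ |minor σ σ' τ i j| := by
  revert h
  unfold minor
  generalize σ i = a; generalize σ' i = b; generalize τ i = c
  generalize σ j = d; generalize σ' j = e; generalize τ j = f
  cases a <;> cases b <;> cases c <;> cases d <;> cases e <;> cases f <;> norm_num [pm]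

/-! ## Step (C3): the order-theoretic skeleton of the Feshbach gap formula -/

/-- **Step (C3).** Let `φ₋ ≤ φ₊` be real functions, both decreasing at rate at least `1`
(`φ(e') − φ(e) ≤ −(e' − e)` for `e < e'`), `φ₊` decreasing at rate at most `1 + θ`, and let `a < b` each be a zero of `φ₋`
or of `φ₊` (in WG: `φ± = λ±(F(e)) − e` for the 2×2 Feshbach matrix, `a = e_k`, `b = e_{k+1}`). Then `a` is the zero of `φ₋`,
`b` the zero of `φ₊`, and the spread at `a` is at most `(1 + θ)(b − a)`, i.e. `gap ≥ spread/(1 + θ)`. (LLA.md WG2 (C3)) [folklore] -/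
theorem gap_skeleton {φm φp : ℝ → ℝ} {θ a b : ℝ} (hab : a < b)
    (hle : ∀ e, φm e ≤ φp e)
    (hm : ∀ e e', e < e' → φm e' - φm e ≤ -(e' - e))
    (hp : ∀ e e', e < e' → φp e' - φp e ≤ -(e' - e))
    (hp' : ∀ e e', e ≤ e' → -((1 + θ) * (e' - e)) ≤ φp e' - φp e)
    (ha : φm a = 0 ∨ φp a = 0) (hb : φm b = 0 ∨ φp b = 0) :
    φm a = 0 ∧ φp b = 0 ∧ φp a - φm a ≤ (1 + θ) * (b - a) := by
  have h1 := hm a b hab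
  have h2 := hp a b hab
  have h3 := hp' a b hab.le
  have hla := hle a
  have hlb := hle b
  have hma : φm a = 0 := by
    rcases ha with h | h
    · exact h
    · -- φp a = 0 ⇒ φm a ≤ 0 ⇒ φm b < 0 ⇒ φp b = 0 ⇒ contradiction with strict decrease of φp
      exfalso
      rcases hb with h' | h'
      · linarith
      · linarith
  have hpb : φp b = 0 := by
    rcases hb with h | h
    · exfalso; linarith
    · exact h
  exact ⟨hma, hpb, by linarith⟩

/-! ## Step (D): the one-variable Wegner estimate for a co-Lipschitz function -/

/-- A `c`-co-Lipschitz real function on a set `I` has small sublevel sets: `Leb{x ∈ I : |u x| < ε} ≤ 2ε/c`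
(the set has diameter `≤ 2ε/c`, and on `ℝ` volume `≤` diameter). (LLA.md WG2 (D)) [folklore] -/
theorem volume_abs_lt_le_of_coLipschitz {I : Set ℝ} {u : ℝ → ℝ} {c ε : ℝ} (hc : 0 < c)
    (hu : ∀ x ∈ I, ∀ y ∈ I, c * |x - y| ≤ |u x - u y|) :
    volume {x ∈ I | |u x| < ε} ≤ ENNReal.ofReal (2 * ε / c) := by
  refine (Real.volume_le_diam _).trans ?_
  refine Metric.ediam_le ?_
  intro x hx y hy
  simp only [mem_setOf_eq] at hx hy
  rw [edist_dist, Real.dist_eq]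
  apply ENNReal.ofReal_le_ofReal
  have h1 := hu x hx.1 y hy.1
  have h2 : |u x - u y| ≤ |u x| + |u y| := abs_sub _ _
  rw [le_div_iff₀ hc]
  nlinarith [abs_nonneg (x - y)]

/-- **Step (D).** If `u x = 2 s x + v x` on `I` with `|s| = 1` and `v` λ-Lipschitz on `I`, `λ < 2`, then `u` is
`(2 − λ)`-co-Lipschitz and `Leb{x ∈ I : |u x| < ε} ≤ 2ε/(2 − λ)`. In WG: `x = h_l` at a site where `σ, σ'` differ, `2 s x` is the
`h_l`-dependence of `E_σ − E_σ'`, `v` collects `D`, `T_σσ − T_σ'σ'` and the second-order Feshbach terms (`λ ≤ 4t₀²/d² = 1/4`),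
`ε = (1 + θ)δ`. (LLA.md WG2 (D)) [folklore] -/
theorem volume_window_le_of_lipschitz_perturbation {I : Set ℝ} {v : ℝ → ℝ} {s lam ε : ℝ} (hs : |s| = 1)
    (hlam : lam < 2) (hv : ∀ x ∈ I, ∀ y ∈ I, |v x - v y| ≤ lam * |x - y|) :
    volume {x ∈ I | |2 * s * x + v x| < ε} ≤ ENNReal.ofReal (2 * ε / (2 - lam)) := by
  apply volume_abs_lt_le_of_coLipschitz (u := fun x => 2 * s * x + v x) (by linarith)
  intro x hx y hy
  have h1 := hv x hx y hy
  have e1 : (2 * s * x + v x) - (2 * s * y + v y) = 2 * s * (x - y) + (v x - v y) := by ring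
  rw [e1]
  have h2 : |2 * s * (x - y)| = 2 * |x - y| := by
    rw [abs_mul, abs_mul, hs]; norm_num
  have h3 : |2 * s * (x - y)| - |v x - v y| ≤ |2 * s * (x - y) + (v x - v y)| := by
    have := abs_sub_abs_le_abs_sub (2 * s * (x - y)) (-(v x - v y))
    rw [abs_neg, sub_neg_eq_add] at this
    exact this
  nlinarith [abs_nonneg (x - y)]

/-! ## The arithmetic of WG -/

/-- The constants of WG: with `K = 4t₀`, `L = 8t₀`: `d = L − K/2 − 2t₀ = 4t₀`, `θ = t₀²/d² = 1/16`, `λ = 4t₀²/d² = 1/4`,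
`KL = 32t₀²`, and the per-interval Wegner length `2(1 + θ)/(2 − λ) = 17/14`. (LLA.md WG2) [folklore] -/
theorem wg_constants (t₀ : ℝ) (ht : 0 < t₀) :
    (8 * t₀ - (4 * t₀) / 2 - 2 * t₀ = 4 * t₀) ∧ (t₀ ^ 2 / (4 * t₀) ^ 2 = 1 / 16) ∧
    (4 * t₀ ^ 2 / (4 * t₀) ^ 2 = 1 / 4) ∧ ((4 * t₀) * (8 * t₀) = 32 * t₀ ^ 2) ∧
    (2 * (1 + (1:ℝ) / 16) / (2 - 1 / 4) = 17 / 14) := by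
  have h0 : t₀ ≠ 0 := ht.ne'
  refine ⟨by ring, ?_, ?_, by ring, by norm_num⟩
  · rw [div_eq_iff (by positivity)]; ring
  · rw [div_eq_iff (by positivity)]; ring

/-- Counting for step (C)–(D): `< N(N−1)/2` unordered pairs times `≤ N − 1` intervals times `17/14` is at most `(17/28) N³`.
(LLA.md WG2 (D)) [folklore] -/
theorem wg_counts_pairs (N : ℝ) (hN : 1 ≤ N) :
    N * (N - 1) / 2 * (N - 1) * (17 / 14) ≤ 17 / 28 * N ^ 3 := by
  nlinarith [mul_nonneg (by linarith : (0:ℝ) ≤ N - 1) (by linarith : (0:ℝ) ≤ N),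
    mul_nonneg (by linarith : (0:ℝ) ≤ N) (by linarith : (0:ℝ) ≤ N)]

/-- Counting for step (B): `N(N−1)(N−2) ≤ N³` ordered triples. (LLA.md WG2 (B)) [folklore] -/
theorem wg_counts_triples (N : ℝ) (hN : 2 ≤ N) : N * (N - 1) * (N - 2) ≤ N ^ 3 := by
  nlinarith [mul_nonneg (by linarith : (0:ℝ) ≤ N - 2) (by linarith : (0:ℝ) ≤ N),
    mul_nonneg (by linarith : (0:ℝ) ≤ N) (by linarith : (0:ℝ) ≤ N)]

/-- The window inequality: for `δ ≥ 32 ρ₀ t₀²` the bound `(17/28) 8^m ρ₀ δ + 32·8^m ρ₀² t₀²` is at most `2·8^m ρ₀ δ`, i.e. the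
LLA shape with `ν = 1`, `C^m = 2ρ₀ 8^m`. [cite: ImbrieJSP2016, eq. (1.3); LLA.md WG1] -/
theorem wg_window_bound (m : ℕ) {ρ₀ δ t₀ : ℝ} (hρ : 0 ≤ ρ₀) (hδ : 32 * ρ₀ * t₀ ^ 2 ≤ δ) :
    17 / 28 * 8 ^ m * ρ₀ * δ + 32 * 8 ^ m * ρ₀ ^ 2 * t₀ ^ 2 ≤ 2 * 8 ^ m * ρ₀ * δ := by
  have h8 : (0:ℝ) ≤ 8 ^ m := by positivity
  have h1 : 32 * 8 ^ m * ρ₀ ^ 2 * t₀ ^ 2 = 8 ^ m * ρ₀ * (32 * ρ₀ * t₀ ^ 2) := by ring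
  rw [h1]
  have h2 : 8 ^ m * ρ₀ * (32 * ρ₀ * t₀ ^ 2) ≤ 8 ^ m * ρ₀ * δ :=
    mul_le_mul_of_nonneg_left hδ (mul_nonneg h8 hρ)
  have hδ0 : 0 ≤ δ := le_trans (by positivity) hδ
  nlinarith [mul_nonneg (mul_nonneg h8 hρ) hδ0]

/-- The Weyl branch (WG-b), `4^m ρ₀ δ`, is dominated by the unified bound `8^m ρ₀ (δ + 32 ρ₀ t₀²)`. (LLA.md WG1) [folklore] -/
theorem wg_weyl_into_unified (m : ℕ) {ρ₀ δ t₀ : ℝ} (hρ : 0 ≤ ρ₀) (hδ : 0 ≤ δ) :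
    4 ^ m * ρ₀ * δ ≤ 8 ^ m * ρ₀ * (δ + 32 * ρ₀ * t₀ ^ 2) := by
  have h48 : (4:ℝ) ^ m ≤ 8 ^ m := pow_le_pow_left₀ (by norm_num) (by norm_num) m
  have h8 : (0:ℝ) ≤ 8 ^ m := by positivity
  have hextra : 0 ≤ 8 ^ m * ρ₀ * (32 * ρ₀ * t₀ ^ 2) := by positivity
  nlinarith [mul_le_mul_of_nonneg_right h48 (mul_nonneg hρ hδ)]

end SecondOrderWindow

end Literature.MathematicalPhysics.QuantumLattice.Imbrie2016
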